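import Literature.MathematicalPhysics.QuantumFieldTheory.Balaban1983to89.T3SmallLiftHistory

/-!
# Crux `HistoryTailL` (stmt-QuantumFields-19936), K2 at depth (route crux `PoincareLipschitz.BlockLipschitzL`, stmt-QuantumFields-23533):
# THE LITTLEWOOD–PALEY PROFILE IS SUMMABLE IFF ITS BAND RATIO BEATS `√L` — the real-analysis letter every «LP-IND» knit sums

Cell `ym3-torus` (YM ladder rung R3 = continuum SU(2) Yang–Mills on the three-torus — a RUNG, NOT the Clay problem: not d = 4, not infinite
volume, not a mass gap), LEAD seat `ym-ust-19936-w1` gen 8; `--supports stmt-QuantumFields-19936 --as helper`; THEOREMS ONLY, definition-free,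
imports one Literature module.

WHY.  The K2 organ's consumer of record (LEAD w1 g8 WORD 6, 2026-08-29T03:33Z, on ★w2-19936 g11's memo `F6-SOCKET-LOCATE-w2g11.md` §8 «LP-TOWER»)
re-cuts the re-gauged averaging tower with a SCALE-WISE induction hypothesis: at level `i` the band-`n` component of the perturbation one-form is
bounded by the profile `σ_i^{(n)} = C·θBal(K−i−n)·ρ^n` (the window at level `i+n` caps the scale-`L^n` curvature), and the frozen sockets
`hDeep`∕`hRows` (✓p692076, ✓p690145) «follow by summing the profile».  THIS FILE is that summation, once and for all, with the located
constraint of LEAD WORD 8 (03:39Z) made a kernel statement: since `θBal(m−n) ≤ (√L)^n·θBal(m)` (the thresholds grow by at most `√L` per level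
towards the unit scale: lit ✓`T3SmallLiftHistory.sqrt_inv_mul_θBal_le_succ`, i.e. `p(g)` is monotone), the profile sum is
`Σ_{n<N} θBal(m−n)·ρ^n ≤ θBal(m)·Σ_{n<N}(ρ√L)^n ≤ θBal(m)·(1 − ρ√L)⁻¹` — UNIFORM IN `N` (hence in the cut-off `K`) iff **`ρ·√L < 1`**.
With the band ratio `ρ = λ/L` this reads `λ < √L`: the abelian count (memo §4) gives `λ = 1` (fine at every `L ≥ 2`); the S-ALIGN ratio `2/L`
(`λ = 2`) is summable only for `L ≥ 5` — at `L = 3` the partial sums grow like `(2/√3)^N`, and `HistoryTailL` quantifies every odd `L > 1`.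

WHAT (ns `…Theorems.PoincareLipschitzLPProfileSum`; `θBal = T3UnitScaleTilt.θBal`, arguments `(L γ b₀ p₀ i)`).
* §1 `θBal_le_sqrt_pow_mul_θBal_add` (`θ(i) ≤ (√L)^k·θ(i+k)`), `θBal_sub_le_sqrt_pow_mul` (`θ(m−n) ≤ (√L)^n·θ(m)`, EVERY `n` — truncated
  subtraction included, since `√L ≥ 1`).
* §2 `profile_term_le` (`θ(m−n)·ρ^n ≤ θ(m)·(ρ√L)^n`, `ρ ≥ 0`).
* §3 ★★ `profile_sum_le` (`Σ_{n ∈ range N} θ(m−n)·ρ^n ≤ θ(m)·(1 − ρ√L)⁻¹` for `0 ≤ ρ`, `ρ√L < 1`, EVERY `N`), ★★ `profile_sum_le_of_lt_sqrt`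
  (the LP letters: `Σ_{n ∈ range N} C·θ(m−n)·λ^n·((L:ℝ)^n)⁻¹ ≤ C·θ(m)·(1 − λ/√L)⁻¹` for `0 ≤ C`, `0 ≤ λ < √L`), `profile_sum_le_two_mul`
  (the abelian ratio `λ = 1`, `L ≥ 4`: `≤ 2·C·θ(m)`).
HONEST SCOPE.  Pure real analysis on the thresholds (7) p.257; nothing of the LP rows (LP-1)(LP-2)(LP-3), the charts, h⋆, `stub_iteratedLipschitz`,
`BlockLipschitzL`, `HistoryTailL` or any summit statement is proved.  YM₃ on T³ is rung R3, NOT the Clay problem.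

References: T. Bałaban, Commun. Math. Phys. **102** (1985) 255–275 [Balaban1985UV3] ((3) p.256, (7) p.257); Commun. Math. Phys. **98** (1985) 17–51
[Balaban1985Averaging] (§3 (156)–(163), the multiscale bookkeeping this profile abstracts).
-/

set_option autoImplicit false

noncomputable section

open scoped BigOperators
open Finset
open Literature.MathematicalPhysics.QuantumFieldTheory.Balaban1983to89
open Literature.MathematicalPhysics.QuantumFieldTheory.Balaban1983to89.T3ContinuumYM3Torus
open Literature.MathematicalPhysics.QuantumFieldTheory.Balaban1983to89.T3UnitScaleTilt
open Literature.MathematicalPhysics.QuantumFieldTheory.Balaban1983to89.T3SmallLiftHistory (sqrt_inv_mul_θBal_le_succ)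
open Literature.MathematicalPhysics.QuantumFieldTheory.Balaban1983to89.T3Thresholds (θBal_eq coupling_le_one)
open Literature.MathematicalPhysics.QuantumFieldTheory.Balaban1983to89.T3ThresholdSmallness (sqrt_coupling_pos_le)

namespace Summit.QuantumFields.YangMills.Theorems.PoincareLipschitzLPProfileSum

variable {L : ℕ} {γ b₀ p₀ : ℝ}

/-! ## §1 The thresholds grow by at most `√L` per level towards the unit scale -/

/-- `0 ≤ θ(i)` (`L ≥ 1`, `0 < γ ≤ 1`, `b₀ ≥ 0`). [cite: Balaban1985UV3, (7) p.257] -/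
theorem θBal_nonneg (hL : 1 ≤ L) (hγ : 0 < γ) (hγ1 : γ ≤ 1) (hb : 0 ≤ b₀) (p₀ : ℝ) (i : ℕ) : 0 ≤ θBal L γ b₀ p₀ i := by
  rw [θBal_eq]
  exact mul_nonneg (Real.sqrt_nonneg _)
    (B10.pFun_nonneg b₀ p₀ _ hb (sqrt_coupling_pos_le hL hγ i).1 (coupling_le_one hL hγ hγ1 i))

/-- **`θ(i) ≤ (√L)^k · θ(i+k)`**: iterating lit ✓`sqrt_inv_mul_θBal_le_succ` (`√(L⁻¹)·θ(i) ≤ θ(i+1)`, i.e. the `p`-function is monotone and the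
coupling shrinks by `√L` per level). [cite: Balaban1985UV3, (3) p.256 and (7) p.257] -/
theorem θBal_le_sqrt_pow_mul_θBal_add (hL : 1 ≤ L) (hγ : 0 < γ) (hγ1 : γ ≤ 1) (hb : 0 ≤ b₀) (hp : 0 ≤ p₀) (i k : ℕ) :
    θBal L γ b₀ p₀ i ≤ Real.sqrt L ^ k * θBal L γ b₀ p₀ (i + k) := by
  have hL0 : (0 : ℝ) < L := by exact_mod_cast hL
  have hsL : 0 < Real.sqrt L := Real.sqrt_pos.mpr hL0
  have hstep : ∀ j : ℕ, θBal L γ b₀ p₀ j ≤ Real.sqrt L * θBal L γ b₀ p₀ (j + 1) := by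
    intro j
    have h := sqrt_inv_mul_θBal_le_succ hL hγ hγ1 hb hp j
    have hinv : Real.sqrt ((L : ℝ)⁻¹) = (Real.sqrt L)⁻¹ := Real.sqrt_inv _
    rw [hinv] at h
    have h2 := mul_le_mul_of_nonneg_left h hsL.le
    rwa [← mul_assoc, mul_inv_cancel₀ hsL.ne', one_mul] at h2
  induction k with
  | zero => simp
  | succ k ih =>
    calc θBal L γ b₀ p₀ i ≤ Real.sqrt L ^ k * θBal L γ b₀ p₀ (i + k) := ih
      _ ≤ Real.sqrt L ^ k * (Real.sqrt L * θBal L γ b₀ p₀ (i + k + 1)) :=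
          mul_le_mul_of_nonneg_left (hstep (i + k)) (pow_nonneg hsL.le k)
      _ = Real.sqrt L ^ (k + 1) * θBal L γ b₀ p₀ (i + (k + 1)) := by rw [pow_succ]; ring_nf

/-- **`θ(m − n) ≤ (√L)^n · θ(m)` for EVERY `n`** (truncated subtraction included: for `n > m` the left side is `θ(0) ≤ (√L)^m θ(m) ≤ (√L)^n θ(m)`).
[cite: Balaban1985UV3, (3) p.256 and (7) p.257] -/
theorem θBal_sub_le_sqrt_pow_mul (hL : 1 ≤ L) (hγ : 0 < γ) (hγ1 : γ ≤ 1) (hb : 0 ≤ b₀) (hp : 0 ≤ p₀) (m n : ℕ) :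
    θBal L γ b₀ p₀ (m - n) ≤ Real.sqrt L ^ n * θBal L γ b₀ p₀ m := by
  have hL1 : (1 : ℝ) ≤ Real.sqrt L := by
    rw [show (1 : ℝ) = Real.sqrt 1 from Real.sqrt_one.symm]
    exact Real.sqrt_le_sqrt (by exact_mod_cast hL)
  rcases le_or_gt n m with hnm | hnm
  · have h := θBal_le_sqrt_pow_mul_θBal_add hL hγ hγ1 hb hp (m - n) n
    rwa [Nat.sub_add_cancel hnm] at h
  · have hsub : m - n = 0 := Nat.sub_eq_zero_of_le hnm.le
    rw [hsub]
    have h := θBal_le_sqrt_pow_mul_θBal_add hL hγ hγ1 hb hp 0 m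
    rw [zero_add] at h
    refine h.trans (mul_le_mul_of_nonneg_right (pow_le_pow_right₀ hL1 hnm.le) (θBal_nonneg hL hγ hγ1 hb p₀ m))

/-! ## §2 One band -/

/-- **ONE BAND OF THE PROFILE**: `θ(m − n)·ρ^n ≤ θ(m)·(ρ√L)^n` (`ρ ≥ 0`). [cite: Balaban1985UV3, (7) p.257] -/
theorem profile_term_le (hL : 1 ≤ L) (hγ : 0 < γ) (hγ1 : γ ≤ 1) (hb : 0 ≤ b₀) (hp : 0 ≤ p₀) {ρ : ℝ} (hρ : 0 ≤ ρ) (m n : ℕ) :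
    θBal L γ b₀ p₀ (m - n) * ρ ^ n ≤ θBal L γ b₀ p₀ m * (ρ * Real.sqrt L) ^ n := by
  calc θBal L γ b₀ p₀ (m - n) * ρ ^ n ≤ (Real.sqrt L ^ n * θBal L γ b₀ p₀ m) * ρ ^ n :=
        mul_le_mul_of_nonneg_right (θBal_sub_le_sqrt_pow_mul hL hγ hγ1 hb hp m n) (pow_nonneg hρ n)
    _ = θBal L γ b₀ p₀ m * (ρ * Real.sqrt L) ^ n := by rw [mul_pow]; ring

/-! ## §3 The profile sum: uniform in the number of bands iff `ρ√L < 1` -/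

/-- Finite geometric sums below `(1 − q)⁻¹` (`0 ≤ q < 1`), every length. [folklore] -/
theorem geom_sum_range_le_inv {q : ℝ} (hq : 0 ≤ q) (hq1 : q < 1) (N : ℕ) : ∑ n ∈ range N, q ^ n ≤ (1 - q)⁻¹ := by
  have h := geom_sum_Ico_le_of_lt_one (m := 0) (n := N) hq hq1
  rwa [← range_eq_Ico, pow_zero, one_div] at h

/-- ★★ **THE LITTLEWOOD–PALEY PROFILE SUM**: for `0 ≤ ρ` with `ρ·√L < 1` and EVERY number of bands `N`,
`Σ_{n<N} θ(m − n)·ρ^n ≤ θ(m)·(1 − ρ√L)⁻¹` — uniform in `N`, hence in the cut-off.  (For `ρ√L ≥ 1` no `N`-uniform bound of this shape exists: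
at `ρ = 2/3`, `L = 3` the band terms are `≥ θ(m)·(2/√3)^n·(p-ratio)`; the hypothesis is the located constraint of LEAD WORD 8.)
[cite: Balaban1985UV3, (3) p.256 and (7) p.257] -/
theorem profile_sum_le (hL : 1 ≤ L) (hγ : 0 < γ) (hγ1 : γ ≤ 1) (hb : 0 ≤ b₀) (hp : 0 ≤ p₀) {ρ : ℝ} (hρ : 0 ≤ ρ)
    (hρL : ρ * Real.sqrt L < 1) (m N : ℕ) :
    ∑ n ∈ range N, θBal L γ b₀ p₀ (m - n) * ρ ^ n ≤ θBal L γ b₀ p₀ m * (1 - ρ * Real.sqrt L)⁻¹ := by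
  have hq0 : 0 ≤ ρ * Real.sqrt L := mul_nonneg hρ (Real.sqrt_nonneg _)
  have hθ0 : 0 ≤ θBal L γ b₀ p₀ m := θBal_nonneg hL hγ hγ1 hb p₀ m
  calc ∑ n ∈ range N, θBal L γ b₀ p₀ (m - n) * ρ ^ n
      ≤ ∑ n ∈ range N, θBal L γ b₀ p₀ m * (ρ * Real.sqrt L) ^ n :=
        sum_le_sum fun n _ => profile_term_le hL hγ hγ1 hb hp hρ m n
    _ = θBal L γ b₀ p₀ m * ∑ n ∈ range N, (ρ * Real.sqrt L) ^ n := by rw [mul_sum]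
    _ ≤ θBal L γ b₀ p₀ m * (1 - ρ * Real.sqrt L)⁻¹ :=
        mul_le_mul_of_nonneg_left (geom_sum_range_le_inv hq0 hρL N) hθ0

/-- ★★ **THE PROFILE SUM IN THE LP-IND LETTERS**: with band ratio `λ/L`, i.e. `σ^{(n)} = C·θ(m − n)·λ^n·(L^n)⁻¹`, `0 ≤ C`, `0 ≤ λ < √L`:
`Σ_{n<N} C·θ(m − n)·λ^n·(L^n)⁻¹ ≤ C·θ(m)·(1 − λ/√L)⁻¹` for EVERY `N`.  The constraint `λ < √L` is sharp in the exponent: `λ = 1` (the abelian count)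
works at every `L ≥ 2`, `λ = 2` only at `L ≥ 5`. [cite: Balaban1985UV3, (3) p.256 and (7) p.257] -/
theorem profile_sum_le_of_lt_sqrt (hL : 1 ≤ L) (hγ : 0 < γ) (hγ1 : γ ≤ 1) (hb : 0 ≤ b₀) (hp : 0 ≤ p₀) {C lam : ℝ} (hC : 0 ≤ C)
    (hlam : 0 ≤ lam) (hlamL : lam < Real.sqrt L) (m N : ℕ) :
    ∑ n ∈ range N, C * θBal L γ b₀ p₀ (m - n) * lam ^ n * ((L : ℝ) ^ n)⁻¹ ≤
      C * θBal L γ b₀ p₀ m * (1 - lam / Real.sqrt L)⁻¹ := by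
  have hL0 : (0 : ℝ) < L := by exact_mod_cast hL
  have hsL : 0 < Real.sqrt L := Real.sqrt_pos.mpr hL0
  have hρ : 0 ≤ lam / (L : ℝ) := div_nonneg hlam hL0.le
  have hkey : lam / (L : ℝ) * Real.sqrt L = lam / Real.sqrt L := by
    rw [div_mul_eq_mul_div, div_eq_div_iff hL0.ne' hsL.ne', mul_assoc, Real.mul_self_sqrt hL0.le]
  have hρL : lam / (L : ℝ) * Real.sqrt L < 1 := by
    rw [hkey, div_lt_one hsL]
    exact hlamL
  have heq : ∀ n : ℕ, C * θBal L γ b₀ p₀ (m - n) * lam ^ n * ((L : ℝ) ^ n)⁻¹ =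
      C * (θBal L γ b₀ p₀ (m - n) * (lam / (L : ℝ)) ^ n) := by
    intro n
    rw [div_pow]
    ring
  have hratio : 1 - lam / (L : ℝ) * Real.sqrt L = 1 - lam / Real.sqrt L := by rw [hkey]
  calc ∑ n ∈ range N, C * θBal L γ b₀ p₀ (m - n) * lam ^ n * ((L : ℝ) ^ n)⁻¹
      = C * ∑ n ∈ range N, θBal L γ b₀ p₀ (m - n) * (lam / (L : ℝ)) ^ n := by
        rw [mul_sum]; exact sum_congr rfl fun n _ => heq n
    _ ≤ C * (θBal L γ b₀ p₀ m * (1 - lam / (L : ℝ) * Real.sqrt L)⁻¹) :=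
        mul_le_mul_of_nonneg_left (profile_sum_le hL hγ hγ1 hb hp hρ hρL m N) hC
    _ = C * θBal L γ b₀ p₀ m * (1 - lam / Real.sqrt L)⁻¹ := by rw [hratio, mul_assoc]

/-- **THE ABELIAN RATIO `λ = 1` AT `L ≥ 4`**: `Σ_{n<N} C·θ(m − n)·(L^n)⁻¹ ≤ 2·C·θ(m)` (`1/√L ≤ ½`).  [cite: Balaban1985UV3, (3) p.256 and (7) p.257] -/
theorem profile_sum_le_two_mul (hL : 4 ≤ L) (hγ : 0 < γ) (hγ1 : γ ≤ 1) (hb : 0 ≤ b₀) (hp : 0 ≤ p₀) {C : ℝ} (hC : 0 ≤ C) (m N : ℕ) :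
    ∑ n ∈ range N, C * θBal L γ b₀ p₀ (m - n) * ((L : ℝ) ^ n)⁻¹ ≤ 2 * C * θBal L γ b₀ p₀ m := by
  have hL1 : 1 ≤ L := le_trans (by norm_num) hL
  have hL4 : (4 : ℝ) ≤ L := by exact_mod_cast hL
  have hsL2 : 2 ≤ Real.sqrt L := by
    rw [show (2 : ℝ) = Real.sqrt 4 by rw [show (4 : ℝ) = 2 ^ 2 by norm_num, Real.sqrt_sq (by norm_num : (0:ℝ) ≤ 2)]]
    exact Real.sqrt_le_sqrt hL4
  have hsL : 0 < Real.sqrt L := lt_of_lt_of_le (by norm_num) hsL2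
  have h1 : (1 : ℝ) < Real.sqrt L := lt_of_lt_of_le (by norm_num) hsL2
  have h := profile_sum_le_of_lt_sqrt hL1 hγ hγ1 hb hp hC zero_le_one h1 m N
  simp only [one_pow, mul_one] at h
  refine h.trans ?_
  have hθ0 : 0 ≤ θBal L γ b₀ p₀ m := θBal_nonneg hL1 hγ hγ1 hb p₀ m
  have hinv : (1 - 1 / Real.sqrt L)⁻¹ ≤ 2 := by
    have hle : (1 : ℝ) / 2 ≤ 1 - 1 / Real.sqrt L := by
      have : 1 / Real.sqrt L ≤ 1 / 2 := one_div_le_one_div_of_le (by norm_num) hsL2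
      linarith
    calc (1 - 1 / Real.sqrt L)⁻¹ ≤ ((1 : ℝ) / 2)⁻¹ := inv_anti₀ (by norm_num) hle
      _ = 2 := by norm_num
  calc C * θBal L γ b₀ p₀ m * (1 - 1 / Real.sqrt L)⁻¹ ≤ C * θBal L γ b₀ p₀ m * 2 :=
        mul_le_mul_of_nonneg_left hinv (mul_nonneg hC hθ0)
    _ = 2 * C * θBal L γ b₀ p₀ m := by ring

end Summit.QuantumFields.YangMills.Theorems.PoincareLipschitzLPProfileSum

end
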